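import Summits.ResolutionOfSingularities.ResolutionOfSingularities.Theorems.FrobeniusLadderFInjectiveMacaulayficationLx3p3ShiftNewtonKFanChecks
import Summits.ResolutionOfSingularities.ResolutionOfSingularities.Theorems.FrobeniusLadderFInjectiveMacaulayficationLx3p3ShiftNewtonKCoverChecks
import HarnessLib

/-!
# CLASS-ROUTE COVERAGE PROGRAMME, BED T SHIFTED `f_T′ = z² − x⁸ + y⁴ + u⁴ + t⁵` (char 3) — THE BINDERS of the class theorem ✓ p656605 `FHalfRowOfNewtonNondegenerate.fHalfRow_of_weaklyNondegenerate` read off the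
# kernel checks: fan side (`hV hgen hge hcov hm haA hv hprimAJ hKprim`, `span_A_eq_floor_mul_K`) and NEWTON side (`hmin`: the common minimiser `u₀ c ∈ supp f_T′` of every chart)
# (crux `FInjectiveMacaulayfication` stmt-ResolutionOfSingularities-15315, chain w45a; (W-WND) class-route COVERAGE PROGRAMME, res-L1-w45a-plan-1 RULING R22.14 (1); seat
# res-L1-w45a-stub-2 g11; data = `Lx3p3ShiftNewtonK{FanTables,CoverRecords}`, kernel checks = `Lx3p3ShiftNewtonK{FanChecks,CoverChecks}`; template = this seatʼs pilot
# ✓ p681513 `Sigma5P2d4CNewtonKFan`)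

Support file for crux stmt-ResolutionOfSingularities-15315 (`FrobeniusLadder.FInjectiveMacaulayfication`), chain w45a.
[OURS · L1 W4.5a] — NOT a statement of any manuscript; AI-written, weaker than expert review.

`f_T′ = z² − x⁸ + y⁴ + u⁴ + t⁵` (`(x,y,u,t,z) = (X 0,…,X 4)`, char 3; `f_T′ = f_T ∘ σ`, `σ : z ↦ z + x⁴`, `f_T` = BED T), centre `𝔪·K` with generator set `A := genSet 5 AL2`,
`AL2 := prodGens 5 KL2` (so `span (x^A) = span (range x̄ⱼ) * span (x^K)` modulo ANY `F`, §2), chart matrices `Vq c` (`= chartV 5 RAYS CL 103 c`), vertices/neighbours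
`chartM/chartA 5 AL2 CL 103`, on the `Σ_f ∧ Σ(𝔪)` fan `Lx3p3s4_fan.json` a9c6dfec19b8da6a (103 unimodular cones, 22 rays). §1 fan-side binders VERBATIM in the shape of
`fHalfRow_of_weaklyNondegenerate` (read off ONE-`decide` kernel checks by the soundness theorems of res-L1-w45a-stub-4's `FanCheckSound*` and this seat's `FanCheckMulti` /
`FanCheckProduct` / `FanCheckChunks`); §2 the product identity and `𝔪 ⊆ √K`; §3 ★ THE NEWTON SIDE: `f_T′` as a sum of five monomials, `coe_mem_SUPPv_of_mem_support` /
`mem_support_of_mem_SUPPv`, and `hmin` — on every chart the tabulated monomial `u₀ c ∈ supp f_T′` minimises every row functional of `Vq c` over `supp f_T′` (the fan refines the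
Newton fan `Σ_f`; the binder of `NewtonChartLemma.exists_theta_eq_monomial_mul_of_commonMinimiser`). No definitions, no named facts.
[folklore; cite: CoxLittleSchenck2011, §2.3; IshiiSingularities2018, proof of Lemma 4.4.24 (p. 96)]
-/

-- single-problem summit: the doubled namespace component is forced
set_option linter.dupNamespace false

noncomputable section

namespace Summit.ResolutionOfSingularities.ResolutionOfSingularities.Theorems.FInjectiveMacaulayfication.Lx3p3ShiftNewtonKFan

open MvPolynomial
open Summit.ResolutionOfSingularities.ResolutionOfSingularities.Theorems.FInjectiveMacaulayfication
open FanCheckKit FanCheckSound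

/-! ## §1 Fan-side binders -/

/-- Every generator of `K` has length 5 (with the specimen-distinct conjunct `CL.length = 103`). -/
theorem klen : (∀ b ∈ KL2.flatten, b.length = 5) ∧ CL.length = 103 := by
  refine ⟨fun b hb => ?_, tlen⟩
  obtain ⟨ch, hch, hbch⟩ := List.mem_flatten.mp hb
  have h := List.all_eq_true.mp check_klen.1 ch hch
  exact allLen_spec h b hbch

/-- ★ THE CENTRE BINDERS: every generator involves a variable (`hprimAJ.1 = hAJ`), and pure powers of all variables lie in `A` (`hprimAJ.2 = hprim`; the centre is `𝔪`-primary). -/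
theorem hprimAJ : (∀ e ∈ genSet 5 AL2, ∃ j ∈ (Finset.univ : Finset (Fin 5)), 0 < e j) ∧
    (∀ j ∈ (Finset.univ : Finset (Fin 5)), ∃ N : ℕ, Finsupp.single j N ∈ genSet 5 AL2) ∧ CL.length = 103 :=
  ⟨hAJ_of_check (n := 5) (r := 0) (AL2 := AL2) (RAYS := RAYS) (CL := CL) shapes.1 check_hAJ.1,
    hprim_of_check (n := 5) (r := 0) (AL2 := AL2) (RAYS := RAYS) (CL := CL) (PJ := PJ) shapes.1 check_hprim.1, tlen⟩

/-- The vertices are generators. -/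
theorem hm : ∀ c : Fin 103, chartM 5 AL2 CL 103 c ∈ genSet 5 AL2 := hm_of_shapes 5 0 AL2 RAYS CL 103 shapes.1 tlen

/-- The neighbours are generators. -/
theorem haA : ∀ (c : Fin 103) (i : Fin 5), chartA 5 AL2 CL 103 c i ∈ genSet 5 AL2 := haA_of_shapes 5 0 AL2 RAYS CL 103 shapes.1 tlen

/-- The chart matrices are unimodular. -/
theorem hV : ∀ c : Fin 103, IsUnit (((Vq c).map (Nat.cast : ℕ → ℤ)).det) := fun c => by
  rw [hVq c]; exact hV_of_check 5 0 AL2 RAYS CL 103 VinvTL shapes.1 tlen check_det.1 c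

/-- (hgen) `V_c a_c i = V_c m_c + e_i`. -/
theorem hgen : ∀ (c : Fin 103) (i : Fin 5), (Finsupp.equivFunOnFinite.symm ((Vq c).mulVec ⇑(chartA 5 AL2 CL 103 c i)) : Fin 5 →₀ ℕ) =
    Finsupp.equivFunOnFinite.symm ((Vq c).mulVec ⇑(chartM 5 AL2 CL 103 c)) + Finsupp.single i 1 := fun c => by
  rw [hVq c]; exact hgen_of_check 5 0 AL2 RAYS CL 103 shapes.1 tlen check_hgen.1 c

/-- (h≥) `m_c` minimises every row of `V_c` over `A`. -/
theorem hge : ∀ (c : Fin 103), ∀ e ∈ genSet 5 AL2, (Finsupp.equivFunOnFinite.symm ((Vq c).mulVec ⇑(chartM 5 AL2 CL 103 c)) : Fin 5 →₀ ℕ) ≤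
    Finsupp.equivFunOnFinite.symm ((Vq c).mulVec ⇑e) := fun c => by
  rw [hVq c]; exact hge_of_check 5 0 AL2 RAYS CL 103 shapes.1 tlen check_hge.1 c

/-- `hcov`: the cover identities `(x^e)^K = x^(m c) · y`, `y ∈ I_A^(K-1)`, from the sparse multi-vertex records, block by block. -/
theorem hcov (k : Type) [Field k] : ∀ e ∈ genSet 5 AL2, ∃ (c : Fin 103) (K : ℕ), 1 ≤ K ∧
    ∃ y ∈ (Ideal.span ((fun b : Fin 5 →₀ ℕ => (MvPolynomial.monomial b (1 : k) : MvPolynomial (Fin 5) k)) '' (genSet 5 AL2 : Set (Fin 5 →₀ ℕ)))) ^ (K - 1),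
      (MvPolynomial.monomial e (1 : k) : MvPolynomial (Fin 5) k) ^ K = MvPolynomial.monomial (chartM 5 AL2 CL 103 c) 1 * y :=
  FanCheckChunks.hcov_of_blocks k KL2 MV2 RAYS CL 50 103 RLMB shapes.1 tlen check_mvbridge check_hcov.1

/-- `hv`: the vertex monomials lie in the image of `I_A` modulo any ideal `F`. -/
theorem hv (k : Type) [Field k] (F : Ideal (MvPolynomial (Fin 5) k)) (c : Fin 103) :
    Ideal.Quotient.mk F (monomial (chartM 5 AL2 CL 103 c) (1 : k)) ∈
      Ideal.span ((fun e : Fin 5 →₀ ℕ => Ideal.Quotient.mk F (monomial e (1 : k))) '' (genSet 5 AL2 : Set (Fin 5 →₀ ℕ))) :=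
  Ideal.subset_span ⟨_, Finset.mem_coe.mpr (hm c), rfl⟩

/-! ## §2 ★ The centre is the PRODUCT `𝔪·K`; `K` is `𝔪`-primary -/

/-- ★ **THE CERTIFIED CENTRE IS LITERALLY THE PRODUCT `𝔪·K`**: in `k[X]/F` (any `F`), `span (x^A) = span (range x̄ⱼ) * span (x^K)` with `K`'s generator set `genSet 5 KL2` —
by `FanCheckProduct.span_genSet_prodGens` (the generator table `AL2` IS `prodGens 5 KL2`); with the specimen-distinct conjunct. [folklore; cite: CoxLittleSchenck2011, §2.3] -/
theorem span_A_eq_floor_mul_K (k : Type) [Field k] (F : Ideal (MvPolynomial (Fin 5) k)) :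
    Ideal.span ((fun e : Fin 5 →₀ ℕ => Ideal.Quotient.mk F (monomial e (1 : k))) '' (genSet 5 AL2 : Set (Fin 5 →₀ ℕ))) =
      Ideal.span (Set.range fun j : Fin 5 => Ideal.Quotient.mk F (X j)) *
        Ideal.span ((fun e : Fin 5 →₀ ℕ => Ideal.Quotient.mk F (monomial e (1 : k))) '' (genSet 5 KL2 : Set (Fin 5 →₀ ℕ))) ∧ CL.length = 103 :=
  ⟨FanCheckProduct.span_genSet_prodGens k F KL2 klen.1, tlen⟩

/-- The pure powers `x^106, y^60, u^60, t^75, z^30` lie in `K`'s generator set: `hKprim` of the class theorem (so `K` is `𝔪`-primary). [folklore] -/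
theorem hKprim : (∀ j : Fin 5, ∃ N : ℕ, Finsupp.single j N ∈ genSet 5 KL2) ∧ CL.length = 103 := by
  have key : ∀ (j : Fin 5) (N : ℕ), (Pi.single j N : Fin 5 → ℕ) ∈ KL2.flatten.map (vecOf 5) → ∃ N : ℕ, Finsupp.single j N ∈ genSet 5 KL2 := by
    intro j N hN
    obtain ⟨l, hl, hlj⟩ := List.mem_map.mp hN
    refine ⟨N, ?_⟩
    have he : expOf 5 l = Finsupp.single j N :=
      DFunLike.coe_injective (by rw [coe_expOf, hlj, Finsupp.single_eq_pi_single])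
    rw [← he]
    exact expOf_mem_genSet hl
  obtain ⟨h0, h1, h2, h3, h4, -⟩ := hKpow
  refine ⟨fun j => ?_, tlen⟩
  fin_cases j
  exacts [key 0 _ h0, key 1 _ h1, key 2 _ h2, key 3 _ h3, key 4 _ h4]

/-! ## §3 ★ The Newton side: the support of `f_T′` and the common minimisers -/

/-- `f_T′` as the sum of its five monomials with exponents read through `Finsupp.equivFunOnFinite.symm` (so that exponent equalities become decidable vector equalities). [folklore] -/
theorem eq_sum_monomial (k : Type) [Field k] (f : MvPolynomial (Fin 5) k) (hf : f = X 4 ^ 2 - X 0 ^ 8 + X 1 ^ 4 + X 2 ^ 4 + X 3 ^ 5) :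
    f = monomial (Finsupp.equivFunOnFinite.symm ![0, 0, 0, 0, 2]) 1 + monomial (Finsupp.equivFunOnFinite.symm ![8, 0, 0, 0, 0]) (-1) +
      monomial (Finsupp.equivFunOnFinite.symm ![0, 4, 0, 0, 0]) 1 + monomial (Finsupp.equivFunOnFinite.symm ![0, 0, 4, 0, 0]) 1 +
      monomial (Finsupp.equivFunOnFinite.symm ![0, 0, 0, 5, 0]) 1 := by
  have hs : ∀ (i : Fin 5) (e : ℕ) (v : Fin 5 → ℕ), (Pi.single i e : Fin 5 → ℕ) = v →
      (X i : MvPolynomial (Fin 5) k) ^ e = monomial (Finsupp.equivFunOnFinite.symm v) 1 := by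
    intro i e v hv
    have he : Finsupp.single i e = Finsupp.equivFunOnFinite.symm v :=
      DFunLike.coe_injective (by rw [Finsupp.single_eq_pi_single, Finsupp.coe_equivFunOnFinite_symm, hv])
    rw [X_pow_eq_monomial, he]
  rw [hf, hs 4 2 ![0, 0, 0, 0, 2] (by decide), hs 0 8 ![8, 0, 0, 0, 0] (by decide), hs 1 4 ![0, 4, 0, 0, 0] (by decide),
    hs 2 4 ![0, 0, 4, 0, 0] (by decide), hs 3 5 ![0, 0, 0, 5, 0] (by decide), sub_eq_add_neg, ← map_neg]

/-- Every support vector of `f_T′`, read as a function, is one of the five tabulated vectors `SUPPv`. [folklore] -/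
theorem coe_mem_SUPPv_of_mem_support (k : Type) [Field k] (f : MvPolynomial (Fin 5) k)
    (hf : f = X 4 ^ 2 - X 0 ^ 8 + X 1 ^ 4 + X 2 ^ 4 + X 3 ^ 5) :
    ∀ u ∈ f.support, (⇑u : Fin 5 → ℕ) ∈ SUPPv := by
  classical
  have leaf : ∀ (v : Fin 5 → ℕ) (c : k) (u : Fin 5 →₀ ℕ), u ∈ (monomial (Finsupp.equivFunOnFinite.symm v) c).support → (⇑u : Fin 5 → ℕ) = v :=
    fun v c u hu => by
      rw [Finset.mem_singleton.mp (support_monomial_subset hu), Finsupp.coe_equivFunOnFinite_symm]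
  intro u hu
  rw [eq_sum_monomial k f hf] at hu
  simp only [SUPPv, List.mem_cons, List.mem_nil_iff, or_false]
  rcases Finset.mem_union.mp (support_add hu) with hu | hu
  · rcases Finset.mem_union.mp (support_add hu) with hu | hu
    · rcases Finset.mem_union.mp (support_add hu) with hu | hu
      · rcases Finset.mem_union.mp (support_add hu) with hu | hu
        · exact Or.inl (leaf _ _ u hu)
        · exact Or.inr (Or.inr (Or.inr (Or.inr (leaf _ _ u hu))))
      · exact Or.inr (Or.inr (Or.inr (Or.inl (leaf _ _ u hu))))
    · exact Or.inr (Or.inr (Or.inl (leaf _ _ u hu)))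
  · exact Or.inr (Or.inl (leaf _ _ u hu))

/-- Conversely, each of the five tabulated vectors IS in the support of `f_T′` (its coefficient is `±1`; any field). [folklore] -/
theorem mem_support_of_mem_SUPPv (k : Type) [Field k] (f : MvPolynomial (Fin 5) k)
    (hf : f = X 4 ^ 2 - X 0 ^ 8 + X 1 ^ 4 + X 2 ^ 4 + X 3 ^ 5) :
    ∀ w ∈ SUPPv, (Finsupp.equivFunOnFinite.symm w : Fin 5 →₀ ℕ) ∈ f.support := by
  classical
  intro w hw
  rw [mem_support_iff, eq_sum_monomial k f hf]
  simp only [coeff_add, coeff_monomial, EmbeddingLike.apply_eq_iff_eq]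
  simp only [SUPPv, List.mem_cons, List.mem_nil_iff, or_false] at hw
  rcases hw with rfl | rfl | rfl | rfl | rfl <;> simp (config := { decide := true })

/-- The tabulated minimiser of chart `c` as an exponent: `u₀ c = U0 c` read as a finsupp. -/
theorem coe_u0 (c : Fin 103) : ⇑(Finsupp.equivFunOnFinite.symm (U0 c) : Fin 5 →₀ ℕ) = U0 c := Finsupp.coe_equivFunOnFinite_symm _

/-- ★ Every tabulated minimiser is a support vector of `f_T′`. -/
theorem hu₀ (k : Type) [Field k] (f : MvPolynomial (Fin 5) k) (hf : f = X 4 ^ 2 - X 0 ^ 8 + X 1 ^ 4 + X 2 ^ 4 + X 3 ^ 5) (c : Fin 103) :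
    (Finsupp.equivFunOnFinite.symm (U0 c) : Fin 5 →₀ ℕ) ∈ f.support :=
  mem_support_of_mem_SUPPv k f hf (U0 c) (hU0_mem c)

/-- ★★ **THE NEWTON BINDER `hmin`**: on every chart the tabulated monomial `u₀ c` minimises every row functional of `Vq c` over `supp f_T′` — the `Σ_f`-refinement of the fan,
in the shape of `NewtonChartLemma.exists_theta_eq_monomial_mul_of_commonMinimiser`. [folklore; cite: IshiiSingularities2018, proof of Lemma 4.4.24 (p. 96)] -/
theorem hmin (k : Type) [Field k] (f : MvPolynomial (Fin 5) k) (hf : f = X 4 ^ 2 - X 0 ^ 8 + X 1 ^ 4 + X 2 ^ 4 + X 3 ^ 5) (c : Fin 103) :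
    ∀ i : Fin 5, ∀ u ∈ f.support, ∑ j, Vq c i j * (Finsupp.equivFunOnFinite.symm (U0 c) : Fin 5 →₀ ℕ) j ≤ ∑ j, Vq c i j * u j := by
  intro i u hu
  have key := hmin_raw c i (⇑u) (coe_mem_SUPPv_of_mem_support k f hf u hu)
  simpa only [Fin.sum_univ_five, coe_u0] using key

end Summit.ResolutionOfSingularities.ResolutionOfSingularities.Theorems.FInjectiveMacaulayfication.Lx3p3ShiftNewtonKFan

end
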